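import Summits.ResolutionOfSingularities.ResolutionOfSingularities.Theorems.WeightedInvariantIota3TauDescentLowDim
import HarnessLib

/-!
# (desc-τ), CASE A′: THE LEX-MAXIMAL DATUM OF THE BASE ASCENDS TO THE CLOSED-FIBRE PRIME `T'_{𝔪_T T'}`
# (door `HypersurfaceCentreConstruction`, stmt-ResolutionOfSingularities-19897; registered stub `stub_keyRungGrHomLE_three`, gap (1) (desc-τ))

Topic: `Summits/ResolutionOfSingularities/ResolutionOfSingularities/Theorems`. Helper for the door item `HypersurfaceCentreConstruction`
(stmt-ResolutionOfSingularities-19897, route `WeightedInvariant`), line `local-engine`, def-free.  Second brick of the flat-pullback argument for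
case (A′) of (desc-τ) («no tie position over a base of dimension two», …Iota3TauDescentLowDim / …Iota3TauDescentBaseTwo): the cylinder
move of a hypothetical tie `(T', φ g)` over a two-dimensional base `T` reads its Abramovich–Quek–Schober datum at `T'_{P₀}`, `P₀ = 𝔪_T T'`
(…Iota3TauDescentBaseTwo); THIS FILE shows that datum is the datum OF `g` IN `T`, pushed forward:

* **`Iota3.isLexMaxWeightedCentreGerm_map_atPrime_of_eq_map_maximalIdeal`** — `φ : T → T'` local, formally smooth, essentially of finite
  type between regular local rings, `dim T = 2`, `P'` a prime of `T'` with `P' = 𝔪_T T'`.  If `(v; w; ℓ)` is the lex-maximal admissible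
  weighted centre germ of `(g) ⊆ T` then `(φ ∘ v; w; ℓ)` is the lex-maximal admissible weighted centre germ of `(φ g) ⊆ T'_{P'}`.
  The composite `T → T' → T'_{P'}` is local, flat, formally smooth, essentially of finite type with `𝔪_T ↦ 𝔪_{T'_{P'}}` (so
  `dim T'_{P'} = 2`, the closed fibre being the residue field) and formally smooth — hence relatively `p`-radically closed — residue field
  extension, so `AQSBaseChange.isLexMaxWeightedCentreGerm_map` applies (same bricks as `Iota3.isLexMaxWeightedCentreGerm_atPrime_map`).

With …TiePresentationTransfer (`IsTiePresentation.weights_eq_of_isLexMax` / `…weightedMonomialIdeal_eq_of_isLexMax`) this identifies the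
weights `(r, q)` and the whole weighted filtration `𝒥ₙ((y, x); (r, q))` of any case-(A′) tie presentation with the EXTENSION of the filtration
of `T`'s own datum — the input of the remaining step (pull the no-drop successor of …TieNoDropSuccessor back along the flat base change of
the cobordant blow-up and contradict `LexMaxOrderDrop.adicOrder_transform_lt_of_isLexMax` on the two-dimensional `T`).

[OURS · L1 W4.3 · (desc-τ) case A′, brick 2]  Replaces the role of NO printed item; NOT a statement of the manuscript under review
[claim: Hironaka2017, status: under-review]; candidates stay candidates; AI work, weaker than expert review.  No definition; no axiom.

## References

* D. Abramovich, M. H. Quek, B. Schober, arXiv:2507.01232 (2025), Thm 3.5 (stability of the centre under separable base change).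
  [AbramovichQuekSchober2025]
* H. Matsumura, *Commutative Ring Theory* (1986), Thm. 15.1, Thm. 23.7, Thm. 26.9. [Matsumura1987]
-/

noncomputable section

set_option linter.dupNamespace false -- mandated namespace `Summit.<Summit>.<Problem>` of this single-conjunct summit

open IsLocalRing Literature.AlgebraicGeometry.Resolution
open Summit.ResolutionOfSingularities.ResolutionOfSingularities.Theorems
open Summit.ResolutionOfSingularities.ResolutionOfSingularities.Theorems.ContactCylinder

namespace Summit.ResolutionOfSingularities.ResolutionOfSingularities.Cruxes.HypersurfaceCentreConstruction.LocalEngine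

namespace Iota3

section AscentToFibrePrime

variable (T T' : Type) [CommRing T] [CommRing T'] [IsRegularLocalRing T] [IsRegularLocalRing T'] [Algebra T T']
  [IsLocalHom (algebraMap T T')] [Algebra.FormallySmooth T T'] [Algebra.EssFiniteType T T']

omit [IsLocalHom (algebraMap T T')] in
/-- **THE LEX-MAXIMAL DATUM OF THE BASE ASCENDS TO `T'_{𝔪_T T'}`.**  `φ : T → T'` local, formally smooth, essentially of finite type between
regular local rings, `dim T = 2`, `P' = 𝔪_T T'` (a prime).  A lex-maximal admissible weighted centre germ `(v; w; ℓ)` of `(g) ⊆ T` pushes forward to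
a lex-maximal admissible weighted centre germ `(φ ∘ v; w; ℓ)` of `(φ g) ⊆ T'_{P'}`. [cite: AbramovichQuekSchober2025, Thm 3.5] -/
theorem isLexMaxWeightedCentreGerm_map_atPrime_of_eq_map_maximalIdeal (hdimT : ringKrullDim T = (2 : ℕ))
    (P' : Ideal T') [P'.IsPrime] (hP' : P' = (maximalIdeal T).map (algebraMap T T'))
    {g : T} {v : Fin 2 → T} {w : Fin 2 → ℕ} {ℓ : ℕ} (hlex : IsLexMaxWeightedCentreGerm T (Ideal.span {g}) v w ℓ) :
    IsLexMaxWeightedCentreGerm (Localization.AtPrime P')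
      (Ideal.span {algebraMap T' (Localization.AtPrime P') (algebraMap T T' g)})
      (fun i => algebraMap T' (Localization.AtPrime P') (algebraMap T T' (v i))) w ℓ := by
  classical
  set B := Localization.AtPrime P' with hB
  -- the instance block of the composite `T → T' → B`
  haveI : IsRegularLocalRing B := isRegularLocalRing_localization_atPrime T' P'
  have h𝔪B : maximalIdeal B = P'.map (algebraMap T' B) := (Localization.AtPrime.map_eq_maximalIdeal).symm
  have h𝔪 : (maximalIdeal T).map (algebraMap T B) = maximalIdeal B := by
    rw [h𝔪B, IsScalarTower.algebraMap_eq T T' B, ← Ideal.map_map, ← hP']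
  haveI : IsLocalHom (algebraMap T B) := by
    refine ⟨fun a ha => ?_⟩
    by_contra hna
    have ha𝔪 : a ∈ maximalIdeal T := (IsLocalRing.mem_maximalIdeal a).mpr (mem_nonunits_iff.mpr hna)
    have h1 : algebraMap T B a ∈ maximalIdeal B := h𝔪 ▸ Ideal.mem_map_of_mem _ ha𝔪
    exact (IsLocalRing.mem_maximalIdeal _).mp h1 ha
  haveI : Algebra.FormallySmooth T' B := Algebra.FormallySmooth.of_isLocalization P'.primeCompl
  haveI : Algebra.EssFiniteType T' B := Algebra.EssFiniteType.of_isLocalization B P'.primeCompl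
  haveI : Algebra.FormallySmooth T B := Algebra.FormallySmooth.comp T T' B
  haveI : Algebra.EssFiniteType T B := Algebra.EssFiniteType.comp T T' B
  haveI : Module.Flat T B := IotaOrderEssSmooth.flat_of_formallySmooth_of_essFiniteType T B
  haveI : Module.FaithfullyFlat T B := Module.FaithfullyFlat.of_flat_of_isLocalHom
  -- `dim B = dim T = 2`: the closed fibre `B ⧸ 𝔪_T B = κ(B)` is a field
  have hdimB : ringKrullDim B = (2 : ℕ) := by
    obtain ⟨a, b, c, ha, hb, hc, hab⟩ := EssSmoothLE2.exists_dims T B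
    have ha2 : a = 2 := by
      have h : ((a : ℕ) : WithBot ℕ∞) = (2 : ℕ) := ha.symm.trans hdimT
      exact_mod_cast h
    have hcongr : ∀ (I J : Ideal B), I = J → ringKrullDim (B ⧸ I) = ringKrullDim (B ⧸ J) := by
      rintro I J rfl; rfl
    have hc0 : c = 0 := by
      have hF : IsField (B ⧸ maximalIdeal B) := (Ideal.Quotient.maximal_ideal_iff_isField_quotient (maximalIdeal B)).mp inferInstance
      have h := (hcongr _ _ h𝔪).symm.trans hc
      rw [ringKrullDim_eq_zero_of_isField hF] at h
      have h' : ((0 : ℕ) : WithBot ℕ∞) = c := by exact_mod_cast h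
      exact_mod_cast h'.symm
    rw [hb, hab, ha2, hc0]
  -- the residue field extension is formally smooth, hence relatively `p`-radically closed
  letI := (IsLocalRing.ResidueField.map (algebraMap T B)).toAlgebra
  haveI : Algebra.FormallySmooth (ResidueField T) (ResidueField B) :=
    AQSBaseChange.formallySmooth_residueField_of_map_maximalIdeal_eq T B h𝔪
  set p := ringExpChar (ResidueField T) with hp
  haveI : ExpChar (ResidueField B) p :=
    expChar_of_injective_ringHom (algebraMap (ResidueField T) (ResidueField B)).injective p
  have hcl : ∀ z : ResidueField B, z ^ p ∈ (IsLocalRing.ResidueField.map (algebraMap T B)).range →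
      z ∈ (IsLocalRing.ResidueField.map (algebraMap T B)).range := fun z hz =>
    AQSBaseChange.mem_range_algebraMap_of_pow_mem (E := ResidueField T) (L := ResidueField B) p hz
  -- the datum ascends
  have key := AQSBaseChange.isLexMaxWeightedCentreGerm_map hdimT hdimB h𝔪 p hcl hlex
  have hφ : ∀ s : T, algebraMap T B s = algebraMap T' B (algebraMap T T' s) := fun s =>
    IsScalarTower.algebraMap_apply T T' B s
  have hv : (fun i => algebraMap T B (v i)) = fun i => algebraMap T' B (algebraMap T T' (v i)) := by
    funext i; exact hφ (v i)
  rw [hφ g, hv] at key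
  exact key

end AscentToFibrePrime

end Iota3

end Summit.ResolutionOfSingularities.ResolutionOfSingularities.Cruxes.HypersurfaceCentreConstruction.LocalEngine

end
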